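import Literature.AlgebraicGeometry.Modules.AffineLocalizingClosure
import Mathlib.AlgebraicGeometry.Morphisms.ClosedImmersion
import HarnessLib

/-!
# The direct image along a closed immersion is fully faithful on sheaves of modules

The Stacks Project, Tag 08KS (Modules, Lemma 17.13.4): "Let `i : (Z, 𝒪_Z) → (X, 𝒪_X)` be a
morphism of ringed spaces. Assume `i` is a homeomorphism onto a closed subset of `X` and
`i♯ : 𝒪_X → i_*𝒪_Z` is surjective. Denote `𝓘 ⊂ 𝒪_X` the kernel of `i♯`. The functor
`i_* : Mod(𝒪_Z) → Mod(𝒪_X)` is exact, fully faithful, with essential image those `𝒪_X`-modules `𝓖`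
such that `𝓘𝓖 = 0`." This file proves the FULL FAITHFULNESS for a closed immersion of schemes
`ι : Z → X` and Mathlib's direct image `Scheme.Modules.pushforward ι : Z.Modules ⥤ X.Modules`
(sections `Γ(ι_*M, V) = Γ(M, ι⁻¹V)`, `Scheme.Modules.pushforward_obj_obj`):

* `extendOpen ι U = X ∖ ι(Z ∖ U)` — the largest open of `X` with `ι⁻¹(extendOpen U) = U`
  (`preimage_liftOpen`; monotone; `V ≤ extendOpen (ι⁻¹V)`); every open `U` of `Z` is covered by the
  preimages `ι⁻¹W` of the AFFINE opens `W ≤ extendOpen U` of `X` (`iSup_preimage_eq`);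
* `preimageHom Φ : M ⟶ N` for `Φ : ι_*M ⟶ ι_*N` — on sections over `U`: restrict to
  `ι⁻¹(extendOpen U) = U`, apply `Φ` over `extendOpen U`, restrict back; it satisfies the formula
  `(preimageHom Φ)(m)|_{ι⁻¹V} = Φ_V(m|_{ι⁻¹V})` for `V ≤ extendOpen U` (`map_preimageApp`), whence
  naturality, and `𝒪_Z`-LINEARITY by locality: on `ι⁻¹W`, `W` affine, a function on `Z` lifts to
  `X` (`Scheme.Hom.app_surjective`) and `Φ` is `𝒪_X`-linear;
* `pushforward_map_preimageHom : ι_*(preimageHom Φ) = Φ`, and the instances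
  `(Scheme.Modules.pushforward ι).Full`, `.Faithful`; `preimageIsoOfPushforward` — an isomorphism
  `ι_*M ≅ ι_*N` comes from a unique `M ≅ N`.

Everything is proved; no named facts. Not here: exactness of `ι_*` and the essential image
(`𝓘𝓖 = 0`), i.e. the other two clauses of Tag 08KS. Mathlib (this pin) has `pushforward f` full
and faithful only for OPEN immersions (`Modules/Sheaf.lean`, via `restrictAdjunction`).

## References

* The Stacks Project, Tag 08KS (Modules, Lemma 17.13.4); Tag 01QY (Morphisms, Lemma 29.4.1, the
  quasi-coherent case). [StacksProject]
-/

noncomputable section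

open CategoryTheory AlgebraicGeometry Limits TopologicalSpace Opposite

universe u

namespace Literature.AlgebraicGeometry.Modules

variable {Z X : Scheme.{u}} (ι : Z ⟶ X) [IsClosedImmersion ι]

/-! ## The largest open of `X` with a given preimage -/

/-- `extendOpen ι U = X ∖ ι(Z ∖ U)`: the largest open subset of `X` whose preimage under the closed
immersion `ι` is the open `U ⊆ Z` (open because `ι` is a closed map). [folklore] -/
def extendOpen (U : Z.Opens) : X.Opens :=
  ⟨(ι.base '' (U : Set Z)ᶜ)ᶜ, (ι.isClosedEmbedding.isClosedMap _ U.isOpen.isClosed_compl).isOpen_compl⟩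

/-- Membership in `extendOpen ι U`: every `ι`-preimage lies in `U`. [folklore] -/
theorem mem_liftOpen_iff (U : Z.Opens) (x : X) :
    x ∈ extendOpen ι U ↔ ∀ z : Z, ι.base z = x → z ∈ U := by
  change x ∉ ι.base '' (U : Set Z)ᶜ ↔ _
  simp only [Set.mem_image, Set.mem_compl_iff, SetLike.mem_coe, not_exists, not_and, not_imp_not]

/-- `ι⁻¹(extendOpen ι U) = U` (`ι` is injective). [folklore] -/
theorem preimage_liftOpen (U : Z.Opens) : ι ⁻¹ᵁ extendOpen ι U = U := by
  ext z
  change ι.base z ∈ extendOpen ι U ↔ z ∈ U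
  rw [mem_liftOpen_iff]
  exact ⟨fun h => h z rfl, fun hz z' hz' => by rwa [ι.isClosedEmbedding.injective hz']⟩

/-- `extendOpen` is monotone. [folklore] -/
theorem liftOpen_mono {U U' : Z.Opens} (h : U ≤ U') : extendOpen ι U ≤ extendOpen ι U' := fun x hx => by
  rw [mem_liftOpen_iff] at hx ⊢
  exact fun z hz => h (hx z hz)

/-- `V ⊆ extendOpen ι (ι⁻¹V)`. [folklore] -/
theorem le_liftOpen_preimage (V : X.Opens) : V ≤ extendOpen ι (ι ⁻¹ᵁ V) := fun x hx => by
  rw [mem_liftOpen_iff]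
  rintro z rfl
  exact hx

/-- A preimage `ι⁻¹V` with `V ≤ extendOpen ι U` lies in `U`. [folklore] -/
theorem preimage_le_of_le_liftOpen {U : Z.Opens} {V : X.Opens} (hV : V ≤ extendOpen ι U) :
    ι ⁻¹ᵁ V ≤ U := fun z hz => by
  have h : z ∈ ι ⁻¹ᵁ extendOpen ι U := hV hz
  rwa [preimage_liftOpen] at h

/-- The index set of the affine opens of `X` inside `extendOpen ι U`. [folklore] -/
abbrev AffinesBelow (U : Z.Opens) : Type u := {W : X.affineOpens // (W : X.Opens) ≤ extendOpen ι U}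

/-- **Every open `U ⊆ Z` is covered by the preimages of the affine opens of `X` inside
`extendOpen ι U`** (affine opens form a basis of `X`, and `ι⁻¹(extendOpen U) = U`). [folklore] -/
theorem iSup_preimage_eq (U : Z.Opens) :
    ⨆ W : AffinesBelow ι U, ι ⁻¹ᵁ ((W.1 : X.affineOpens) : X.Opens) = U := by
  refine le_antisymm (iSup_le fun W => preimage_le_of_le_liftOpen ι W.2) fun z hz => ?_
  have hz' : ι.base z ∈ extendOpen ι U := by
    rw [← preimage_liftOpen ι U] at hz
    exact hz
  obtain ⟨W, hW, hzW, hWle⟩ := Opens.isBasis_iff_nbhd.mp X.isBasis_affineOpens hz'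
  exact Opens.mem_iSup.mpr ⟨⟨⟨W, hW⟩, hWle⟩, hzW⟩

/-! ## The morphism `M → N` underlying a morphism `ι_*M → ι_*N` -/

section Preimage

variable {M N : Z.Modules}
  (Φ : (Scheme.Modules.pushforward ι).obj M ⟶ (Scheme.Modules.pushforward ι).obj N)

omit [IsClosedImmersion ι] in
/-- Restriction maps of `ι_*N` are restriction maps of `N` between preimages. [folklore] -/
theorem pushforward_presheaf_map_eq {V V' : X.Opens} (h : V' ≤ V) :
    ((Scheme.Modules.pushforward ι).obj N).presheaf.map (homOfLE h).op =
      N.presheaf.map (homOfLE (show ι ⁻¹ᵁ V' ≤ ι ⁻¹ᵁ V from fun _ hz => h hz)).op := by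
  rw [Scheme.Modules.pushforward_obj_presheaf_map]
  rfl

omit [IsClosedImmersion ι] in
/-- **Naturality of `Φ` read on `Z`**: for `V' ≤ V`, restricting `Φ_V(x)` from `ι⁻¹V` to `ι⁻¹V'`
gives `Φ_{V'}(x|_{ι⁻¹V'})`. [folklore] -/
theorem map_app_pushforward {V V' : X.Opens} (h : V' ≤ V) (x : Γ(M, ι ⁻¹ᵁ V)) :
    N.presheaf.map (homOfLE (show ι ⁻¹ᵁ V' ≤ ι ⁻¹ᵁ V from fun _ hz => h hz)).op
        ((Φ.app V : Γ(M, ι ⁻¹ᵁ V) → Γ(N, ι ⁻¹ᵁ V)) x) =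
      (Φ.app V' : Γ(M, ι ⁻¹ᵁ V') → Γ(N, ι ⁻¹ᵁ V'))
        (M.presheaf.map (homOfLE (show ι ⁻¹ᵁ V' ≤ ι ⁻¹ᵁ V from fun _ hz => h hz)).op x) := by
  have e := map_app Φ h x
  rw [pushforward_presheaf_map_eq ι h, pushforward_presheaf_map_eq ι h] at e
  exact e

/-- The additive map `Γ(M, U) → Γ(N, U)` underlying `Φ` at `U`: restrict to `ι⁻¹(extendOpen U) = U`,
apply `Φ` over `extendOpen U`, restrict back. [folklore] -/
def preimageApp (U : Z.Opens) : Γ(M, U) →+ Γ(N, U) :=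
  (N.presheaf.map (homOfLE (preimage_liftOpen ι U).ge).op).hom.comp
    ((Φ.app (extendOpen ι U)).hom.comp (M.presheaf.map (homOfLE (preimage_liftOpen ι U).le).op).hom)

/-- Unfolding `preimageApp`. [folklore] -/
theorem preimageApp_apply (U : Z.Opens) (m : Γ(M, U)) :
    preimageApp ι Φ U m = N.presheaf.map (homOfLE (preimage_liftOpen ι U).ge).op
      ((Φ.app (extendOpen ι U) : Γ(M, ι ⁻¹ᵁ extendOpen ι U) → Γ(N, ι ⁻¹ᵁ extendOpen ι U))
        (M.presheaf.map (homOfLE (preimage_liftOpen ι U).le).op m)) := rfl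

/-- Restriction maps of `N` compose (elementwise). [folklore] -/
private theorem presheaf_map_of_le_of_le (P : Z.Modules) {U₁ U₂ U₃ : Z.Opens} (h₁₂ : U₂ ≤ U₁) (h₂₃ : U₃ ≤ U₂)
    (x : Γ(P, U₁)) :
    P.presheaf.map (homOfLE h₂₃).op (P.presheaf.map (homOfLE h₁₂).op x) =
      P.presheaf.map (homOfLE (h₂₃.trans h₁₂)).op x := by
  change (P.presheaf.map (homOfLE h₁₂).op ≫ P.presheaf.map (homOfLE h₂₃).op) x = _
  rw [← Functor.map_comp]
  rfl

/-- Proof-irrelevance of the inequality in a restriction map. [folklore] -/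
private theorem presheaf_map_irrel (P : Z.Modules) {U₁ U₂ : Z.Opens} (h h' : U₂ ≤ U₁) (x : Γ(P, U₁)) :
    P.presheaf.map (homOfLE h).op x = P.presheaf.map (homOfLE h').op x := rfl

/-- Restriction along `U ≤ U` is the identity. [folklore] -/
private theorem presheaf_map_le_refl (P : Z.Modules) {U : Z.Opens} (h : U ≤ U) (x : Γ(P, U)) :
    P.presheaf.map (homOfLE h).op x = x := by
  have e : (homOfLE h).op = 𝟙 (op U) := Subsingleton.elim _ _
  rw [e, P.presheaf.map_id]
  rfl

/-- **The restriction formula**: for `V ≤ extendOpen ι U` (so that `ι⁻¹V ⊆ U`),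
`(preimageApp Φ U m)|_{ι⁻¹V} = Φ_V(m|_{ι⁻¹V})`. [folklore] -/
theorem map_preimageApp (U : Z.Opens) {V : X.Opens} (hV : V ≤ extendOpen ι U) (m : Γ(M, U)) :
    N.presheaf.map (homOfLE (preimage_le_of_le_liftOpen ι hV)).op (preimageApp ι Φ U m) =
      (Φ.app V : Γ(M, ι ⁻¹ᵁ V) → Γ(N, ι ⁻¹ᵁ V))
        (M.presheaf.map (homOfLE (preimage_le_of_le_liftOpen ι hV)).op m) := by
  rw [preimageApp_apply, presheaf_map_of_le_of_le,
    presheaf_map_irrel N _ (show ι ⁻¹ᵁ V ≤ ι ⁻¹ᵁ extendOpen ι U from fun _ hz => hV hz),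
    map_app_pushforward ι Φ hV, presheaf_map_of_le_of_le]

/-- `preimageApp` commutes with restriction. [folklore] -/
theorem map_preimageApp_of_le {U U' : Z.Opens} (h : U' ≤ U) (m : Γ(M, U)) :
    N.presheaf.map (homOfLE h).op (preimageApp ι Φ U m) =
      preimageApp ι Φ U' (M.presheaf.map (homOfLE h).op m) := by
  have hle : extendOpen ι U' ≤ extendOpen ι U := liftOpen_mono ι h
  have h₁ : U' ≤ ι ⁻¹ᵁ extendOpen ι U' := (preimage_liftOpen ι U').ge
  rw [← presheaf_map_of_le_of_le N (preimage_le_of_le_liftOpen ι hle) h₁, map_preimageApp ι Φ U hle m,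
    preimageApp_apply, presheaf_map_of_le_of_le]

/-- **`𝒪_Z`-linearity on the preimage of an affine open**: over `ι⁻¹W`, `W ≤ extendOpen ι U` affine,
`preimageApp Φ U (s • m)` and `s • preimageApp Φ U m` agree — a function on `ι⁻¹W` lifts to `W`
(`ι` is a closed immersion, `Scheme.Hom.app_surjective`) and `Φ` is `𝒪_X`-linear. [folklore] -/
theorem map_preimageApp_smul (U : Z.Opens) {W : X.Opens} (hW : IsAffineOpen W)
    (hWU : W ≤ extendOpen ι U) (s : Γ(Z, U)) (m : Γ(M, U)) :
    N.presheaf.map (homOfLE (preimage_le_of_le_liftOpen ι hWU)).op (preimageApp ι Φ U (s • m)) =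
      N.presheaf.map (homOfLE (preimage_le_of_le_liftOpen ι hWU)).op (s • preimageApp ι Φ U m) := by
  have hle := preimage_le_of_le_liftOpen ι hWU
  obtain ⟨t, ht⟩ := ι.app_surjective W hW (Z.presheaf.map (homOfLE hle).op s)
  rw [map_preimageApp ι Φ U hWU, Scheme.Modules.map_smul, Scheme.Modules.map_smul,
    map_preimageApp ι Φ U hWU, ← ht]
  exact Scheme.Modules.Hom.app_smul Φ t (M.presheaf.map (homOfLE hle).op m)

/-- **`preimageApp` is `𝒪_Z`-linear** (by locality in `N` over the cover of `U` by the `ι⁻¹W`,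
`W ≤ extendOpen ι U` affine). [folklore] -/
theorem preimageApp_smul (U : Z.Opens) (s : Γ(Z, U)) (m : Γ(M, U)) :
    preimageApp ι Φ U (s • m) = s • preimageApp ι Φ U m := by
  refine TopCat.Sheaf.eq_of_locally_eq' (⟨N.presheaf, N.isSheaf⟩ : TopCat.Sheaf Ab Z)
    (fun W : AffinesBelow ι U => ι ⁻¹ᵁ ((W.1 : X.affineOpens) : X.Opens)) U
    (fun W => homOfLE (preimage_le_of_le_liftOpen ι W.2)) (iSup_preimage_eq ι U).ge _ _ fun W => ?_
  exact map_preimageApp_smul ι Φ U W.1.2 W.2 s m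

/-- **The morphism `M ⟶ N` underlying `Φ : ι_*M ⟶ ι_*N`.** [cite: StacksProject, Tag 08KS (Modules, Lemma 17.13.4)] -/
def preimageHom : M ⟶ N where
  val := PresheafOfModules.homMk
    { app := fun U => AddCommGrpCat.ofHom (preimageApp ι Φ U.unop)
      naturality := fun {U U'} i => by
        ext m
        change preimageApp ι Φ U'.unop (M.presheaf.map i m) =
          N.presheaf.map i (preimageApp ι Φ U.unop m)
        have hi : i = (homOfLE (leOfHom i.unop)).op := Subsingleton.elim _ _
        rw [hi]
        exact (map_preimageApp_of_le ι Φ (leOfHom i.unop) m).symm }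
    fun U s m => preimageApp_smul ι Φ U.unop s m

/-- Sections of `preimageHom`. [folklore] -/
theorem preimageHom_app_apply (U : Z.Opens) (m : Γ(M, U)) :
    (preimageHom ι Φ).app U m = preimageApp ι Φ U m := rfl

/-- **`ι_*(preimageHom Φ) = Φ`.** [cite: StacksProject, Tag 08KS (Modules, Lemma 17.13.4)] -/
theorem pushforward_map_preimageHom : (Scheme.Modules.pushforward ι).map (preimageHom ι Φ) = Φ := by
  refine Scheme.Modules.hom_ext _ _ fun V => ?_
  ext x
  rw [Scheme.Modules.pushforward_map_app]
  change preimageApp ι Φ (ι ⁻¹ᵁ V) x = (Φ.app V : Γ(M, ι ⁻¹ᵁ V) → Γ(N, ι ⁻¹ᵁ V)) x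
  have h := map_preimageApp ι Φ (ι ⁻¹ᵁ V) (le_liftOpen_preimage ι V) x
  rwa [presheaf_map_le_refl, presheaf_map_le_refl] at h

end Preimage

/-! ## Full faithfulness -/

/-- **`ι_*` is faithful** for a closed immersion `ι` (every open of `Z` is a preimage).
[cite: StacksProject, Tag 08KS (Modules, Lemma 17.13.4)] -/
instance faithful_pushforward : (Scheme.Modules.pushforward ι).Faithful where
  map_injective {M N} φ ψ h := by
    refine Scheme.Modules.hom_ext _ _ fun U => ?_
    have hV := congrArg (fun Ψ => Scheme.Modules.Hom.app Ψ (extendOpen ι U)) h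
    simp only [Scheme.Modules.pushforward_map_app] at hV
    have key : ∀ W : Z.Opens, W = U → φ.app W = ψ.app W → φ.app U = ψ.app U := by
      rintro W rfl h'
      exact h'
    exact key _ (preimage_liftOpen ι U) hV

/-- **`ι_*` is full** for a closed immersion `ι`. [cite: StacksProject, Tag 08KS (Modules, Lemma 17.13.4)] -/
instance full_pushforward : (Scheme.Modules.pushforward ι).Full where
  map_surjective Φ := ⟨preimageHom ι Φ, pushforward_map_preimageHom ι Φ⟩

/-- **`ι_* : Z.Modules ⥤ X.Modules` is fully faithful for a closed immersion `ι : Z → X`**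
(The Stacks Project, Tag 08KS). [cite: StacksProject, Tag 08KS (Modules, Lemma 17.13.4)] -/
def fullyFaithfulPushforward : (Scheme.Modules.pushforward ι).FullyFaithful :=
  Functor.FullyFaithful.ofFullyFaithful _

/-- An isomorphism `ι_*M ≅ ι_*N` of direct images along a closed immersion comes from an
isomorphism `M ≅ N`. [cite: StacksProject, Tag 08KS (Modules, Lemma 17.13.4)] -/
def preimageIsoOfPushforward {M N : Z.Modules}
    (e : (Scheme.Modules.pushforward ι).obj M ≅ (Scheme.Modules.pushforward ι).obj N) : M ≅ N :=
  (fullyFaithfulPushforward ι).preimageIso e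

/-- `ι_*` of the isomorphism `preimageIsoOfPushforward e` is `e`. [folklore] -/
theorem pushforward_map_preimageIsoOfPushforward_hom {M N : Z.Modules}
    (e : (Scheme.Modules.pushforward ι).obj M ≅ (Scheme.Modules.pushforward ι).obj N) :
    (Scheme.Modules.pushforward ι).map (preimageIsoOfPushforward ι e).hom = e.hom :=
  (fullyFaithfulPushforward ι).map_preimage e.hom

end Literature.AlgebraicGeometry.Modules

end
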